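import Summits.ResolutionOfSingularities.ResolutionOfSingularities.Theorems.WeightedInvariantOrbitChartCutsOrbit
import Summits.ResolutionOfSingularities.ResolutionOfSingularities.Theorems.WeightedInvariantGermContractionChart
import Literature.AlgebraicGeometry.Resolution.CanonicalResolutionProofs
import Literature.AlgebraicGeometry.Resolution.PointBlowupHsFunMono
import Mathlib.RingTheory.Ideal.KrullsHeightTheorem
import HarnessLib

/-!
# F-AQS-T in the kernel, (o25-γ) GLOBALISATION — preliminaries: spreading out an equality of localized ideals,
# lifting germs to sections, and the reduced closed subscheme `closure {η}` on an affine chart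

Route `ResolutionOfSingularities/WeightedInvariant`, door crux `HypersurfaceCentreConstruction`
(stmt-ResolutionOfSingularities-19897) — OURS, helper; ORDER (o25) «F-AQS-T in the kernel» of `res-L1-w43-plan-1`,
piece (γ) GLOBALISATION (res-type-047).  Scheme/commutative-algebra plumbing used by
`…Theorems/WeightedInvariantLexMaxCentreGlobal.lean`:

* §1 `exists_not_mem_forall_map_eq` — spreading out: for `A` Noetherian and `I ≤ 𝔭` with `𝔭 A_𝔭 ≤ I A_𝔭`, there is
  `s ∉ 𝔭` with `I A_𝔮 = 𝔭 A_𝔮` for every prime `𝔮 ∌ s` (at every localization at such `𝔮`);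
* §2 `exists_affineOpens_forall_germ_eq` — finitely many germs at a point are germs of sections of ONE affine open
  inside any given neighbourhood;
* §3 the reduced closed subscheme `closure {η}` (`Scheme.IdealSheafData.vanishingIdeal`) on an affine chart
  `W ∋ η`: `fromSpec_mem_closure_iff` (a point of `Spec Γ(Y, W)` maps into `closure {η}` iff its prime contains the
  prime of `η`), `vanishingIdeal_closure_ideal_eq` (`𝓘(closure {η})(W) = 𝔭_η`),
  `stalkIdeal_vanishingIdeal_closure_eq` (`𝓘(closure {η})_y = 𝔭_η 𝒪_{Y,y}`),
  `isRegularLocalRing_quotient_map_primeIdealOf` (a regular point `y` of `closure {η}` has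
  `𝒪_{Y,y} ⧸ 𝔭_η 𝒪_{Y,y}` regular, via Literature `isRegularLocalRing_stalk_subscheme_iff`),
  `isRegularLocalRing_quotient_map_primeIdealOf_self` (at `η` the quotient is the residue field).

No definitions.  Nothing here is a claim about Hironaka's problem or about any manuscript under adjudication;
AI-written, weaker than expert review.
-/

noncomputable section

set_option linter.dupNamespace false -- mandated namespace of this single-conjunct summit

namespace Summit.ResolutionOfSingularities.ResolutionOfSingularities.Theorems.LexMaxCentreGlobal

universe u

open CategoryTheory AlgebraicGeometry TopologicalSpace IsLocalRing Opposite
open Literature.AlgebraicGeometry.Resolution Scheme.IdealSheafData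

/-! ## §1 Two ideals that agree at a prime agree at all primes of a basic open neighbourhood -/

/-- **Spreading out an equality of localized ideals.**  Let `A` be Noetherian, `𝔭` a prime, and `I ≤ 𝔭` an ideal
with `𝔭 · A_𝔭 ≤ I · A_𝔭` (so `I · A_𝔭 = 𝔭 · A_𝔭`).  Then there is `s ∉ 𝔭` such that `I · A_𝔮 = 𝔭 · A_𝔮` for every
prime `𝔮 ∌ s` (finitely many generators of `𝔭`, each a multiple of `I` after inverting some element outside `𝔭`).
[folklore] -/
theorem exists_not_mem_forall_map_eq {A : Type u} [CommRing A] [IsNoetherianRing A] (I 𝔭 : Ideal A)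
    [𝔭.IsPrime] (hI : I ≤ 𝔭) (O : Type u) [CommRing O] [Algebra A O] [IsLocalization.AtPrime O 𝔭]
    (hIO : 𝔭.map (algebraMap A O) ≤ I.map (algebraMap A O)) :
    ∃ s : A, s ∉ 𝔭 ∧ ∀ (𝔮 : Ideal A) [𝔮.IsPrime], s ∉ 𝔮 →
      ∀ (O' : Type u) [CommRing O'] [Algebra A O'] [IsLocalization.AtPrime O' 𝔮],
        I.map (algebraMap A O') = 𝔭.map (algebraMap A O') := by
  classical
  obtain ⟨G, hG⟩ := (IsNoetherian.noetherian 𝔭 : 𝔭.FG)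
  have hmult : ∀ g : A, g ∈ 𝔭 → ∃ m ∈ 𝔭.primeCompl, m * g ∈ I := by
    intro g hg
    have h1 : algebraMap A O g ∈ I.map (algebraMap A O) := hIO (Ideal.mem_map_of_mem _ hg)
    exact (IsLocalization.algebraMap_mem_map_algebraMap_iff 𝔭.primeCompl O _ g).mp h1
  choose m hm hmg using hmult
  let s : A := G.attach.prod fun g => m g.1 (hG ▸ Ideal.subset_span g.2)
  refine ⟨s, ?_, ?_⟩
  · have hs : s ∈ 𝔭.primeCompl := prod_mem fun (g : {a // a ∈ G}) _ => hm g.1 _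
    exact hs
  · intro 𝔮 _ hs O' _ _ _
    apply le_antisymm
    · exact Ideal.map_mono hI
    · rw [← hG, Ideal.map_span, Ideal.span_le]
      rintro _ ⟨g, hg, rfl⟩
      have hmq : m g (hG ▸ Ideal.subset_span hg) ∉ 𝔮 := by
        intro h
        exact hs ((Ideal.IsPrime.prod_mem_iff (p := 𝔮)).mpr ⟨⟨g, hg⟩, G.mem_attach _, h⟩)
      have hu : IsUnit (algebraMap A O' (m g (hG ▸ Ideal.subset_span hg))) :=
        IsLocalization.map_units O' (⟨_, hmq⟩ : 𝔮.primeCompl)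
      have hmem : algebraMap A O' (m g (hG ▸ Ideal.subset_span hg) * g) ∈ I.map (algebraMap A O') :=
        Ideal.mem_map_of_mem _ (hmg g _)
      rw [map_mul] at hmem
      exact (Ideal.unit_mul_mem_iff_mem _ hu).mp hmem

/-! ## §2 Lifting finitely many germs to sections of one affine open -/

/-- Finitely many germs at `η` are the germs of sections over a common affine open neighbourhood of `η` inside any
given open neighbourhood. [folklore] -/
theorem exists_affineOpens_forall_germ_eq {Y : Scheme.{u}} {η : Y} (V : Y.Opens) (hηV : η ∈ V) {m : ℕ}
    (x : Fin m → Y.presheaf.stalk η) :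
    ∃ (W : Y.affineOpens) (hηW : η ∈ (W : Y.Opens)), (W : Y.Opens) ≤ V ∧
      ∃ f : Fin m → Γ(Y, W), ∀ i, (Y.presheaf.germ (W : Y.Opens) η hηW).hom (f i) = x i := by
  classical
  have h := fun i => TopCat.Presheaf.exists_germ_eq Y.presheaf (x i)
  choose U hU s hs using h
  -- a common affine neighbourhood inside `V` and all the `U i`
  let V' : Y.Opens :=
    ⟨(V : Set Y) ∩ ⋂ i, (U i : Set Y), V.2.inter (isOpen_iInter_of_finite fun i => (U i).2)⟩
  have hηV' : η ∈ V' := ⟨hηV, Set.mem_iInter.mpr hU⟩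
  obtain ⟨W, hW, hηW, hWV'⟩ := exists_isAffineOpen_mem_and_subset hηV'
  have hWV : W ≤ V := fun y hy => (hWV' hy).1
  have hWU : ∀ i, W ≤ U i := fun i y hy => Set.mem_iInter.mp (hWV' hy).2 i
  refine ⟨⟨W, hW⟩, hηW, hWV, fun i => (Y.presheaf.map (homOfLE (hWU i)).op).hom (s i), fun i => ?_⟩
  change (Y.presheaf.germ W η hηW).hom ((Y.presheaf.map (homOfLE (hWU i)).op).hom (s i)) = x i
  rw [TopCat.Presheaf.germ_res_apply]
  exact hs i


/-! ## §3 The closure of a point on an affine chart: its reduced ideal is the prime of the point -/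

section Closure

variable {Y : Scheme.{u}} (W : Y.affineOpens) {η : Y} (hηW : η ∈ (W : Y.Opens))

/-- On the chart `Spec Γ(Y, W) → Y`, a point maps into `closure {η}` iff its prime contains the prime of `η`.
[folklore] -/
theorem fromSpec_mem_closure_iff (t : PrimeSpectrum Γ(Y, W)) :
    W.2.fromSpec.base t ∈ closure ({η} : Set Y) ↔ (W.2.primeIdealOf ⟨η, hηW⟩).asIdeal ≤ t.asIdeal := by
  constructor
  · exact fun h => le_asIdeal_of_fromSpec_mem_closure W hηW t h
  · intro h
    have hspec : W.2.primeIdealOf ⟨η, hηW⟩ ⤳ t :=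
      (PrimeSpectrum.le_iff_specializes _ t).mp ((PrimeSpectrum.asIdeal_le_asIdeal _ t).mp h)
    have h2 := hspec.map W.2.fromSpec.base.hom.continuous
    rw [IsAffineOpen.fromSpec_primeIdealOf] at h2
    exact specializes_iff_mem_closure.mp h2

/-- **The reduced ideal of `closure {η}` on an affine chart `W ∋ η` is the prime of `η`.** [folklore] -/
theorem vanishingIdeal_closure_ideal_eq :
    (vanishingIdeal ⟨closure ({η} : Set Y), isClosed_closure⟩).ideal W =
      (W.2.primeIdealOf ⟨η, hηW⟩).asIdeal := by
  rw [vanishingIdeal_ideal]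
  apply le_antisymm
  · intro f hf
    have hmem : W.2.primeIdealOf ⟨η, hηW⟩ ∈ W.2.fromSpec.base ⁻¹' closure ({η} : Set Y) := by
      show W.2.fromSpec.base (W.2.primeIdealOf ⟨η, hηW⟩) ∈ closure ({η} : Set Y)
      rw [IsAffineOpen.fromSpec_primeIdealOf]
      exact subset_closure (Set.mem_singleton η)
    exact (PrimeSpectrum.mem_vanishingIdeal _ _).mp hf _ hmem
  · intro f hf
    refine (PrimeSpectrum.mem_vanishingIdeal _ _).mpr fun t ht => ?_
    exact (fromSpec_mem_closure_iff W hηW t).mp ht hf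

/-- **The stalk of the reduced ideal of `closure {η}` at a point `y ∈ W` is `𝔭_η · 𝒪_{Y,y}`.** [folklore] -/
theorem stalkIdeal_vanishingIdeal_closure_eq {y : Y} (hyW : y ∈ (W : Y.Opens)) :
    stalkIdeal (vanishingIdeal ⟨closure ({η} : Set Y), isClosed_closure⟩) y =
      ((W.2.primeIdealOf ⟨η, hηW⟩).asIdeal).map (Y.presheaf.germ (W : Y.Opens) y hyW).hom := by
  rw [stalkIdeal_eq_map_germ _ W hyW, vanishingIdeal_closure_ideal_eq W hηW]

/-- **Regularity of the orbit closure read in the ambient local ring**: if `y ∈ closure {η} ∩ W` is the image of a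
point of the reduced closed subscheme `closure {η}` with regular local ring, then `𝒪_{Y,y} ⧸ 𝔭_η·𝒪_{Y,y}` is a
regular local ring. [folklore] -/
theorem isRegularLocalRing_quotient_map_primeIdealOf {y : Y} (hyW : y ∈ (W : Y.Opens))
    (y' : (vanishingIdeal ⟨closure ({η} : Set Y), isClosed_closure⟩).subscheme)
    (hy' : (vanishingIdeal ⟨closure ({η} : Set Y), isClosed_closure⟩).subschemeι.base y' = y)
    (hreg : IsRegularLocalRing
      ((vanishingIdeal ⟨closure ({η} : Set Y), isClosed_closure⟩).subscheme.presheaf.stalk y')) :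
    IsRegularLocalRing (Y.presheaf.stalk y ⧸
      ((W.2.primeIdealOf ⟨η, hηW⟩).asIdeal).map (Y.presheaf.germ (W : Y.Opens) y hyW).hom) := by
  have h := (isRegularLocalRing_stalk_subscheme_iff _ y').mp hreg
  rw [← stalkIdeal_vanishingIdeal_closure_eq W hηW hyW]
  subst hy'
  exact h

end Closure

/-- `𝒪_{Y,η} ⧸ 𝔭_η·𝒪_{Y,η}` is a field, hence a regular local ring (the generic point of `closure {η}` is a regular
point of its reduced structure). [folklore] -/
theorem isRegularLocalRing_quotient_map_primeIdealOf_self {Y : Scheme.{u}} (W : Y.affineOpens) {η : Y}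
    (hηW : η ∈ (W : Y.Opens)) :
    IsRegularLocalRing (Y.presheaf.stalk η ⧸
      ((W.2.primeIdealOf ⟨η, hηW⟩).asIdeal).map (Y.presheaf.germ (W : Y.Opens) η hηW).hom) := by
  letI : Algebra Γ(Y, W) (Y.presheaf.stalk η) := TopCat.Presheaf.algebra_section_stalk Y.presheaf ⟨η, hηW⟩
  haveI := W.2.isLocalization_stalk ⟨η, hηW⟩
  have hmax : ((W.2.primeIdealOf ⟨η, hηW⟩).asIdeal).map (Y.presheaf.germ (W : Y.Opens) η hηW).hom =
      maximalIdeal (Y.presheaf.stalk η) := by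
    change ((W.2.primeIdealOf ⟨η, hηW⟩).asIdeal).map (algebraMap Γ(Y, W) (Y.presheaf.stalk η)) = _
    rw [← IsLocalization.AtPrime.under_maximalIdeal (Y.presheaf.stalk η) (W.2.primeIdealOf ⟨η, hηW⟩).asIdeal,
      Ideal.under_def, IsLocalization.map_under (W.2.primeIdealOf ⟨η, hηW⟩).asIdeal.primeCompl
        (S := Y.presheaf.stalk η)]
  rw [hmax]
  letI : Field (Y.presheaf.stalk η ⧸ maximalIdeal (Y.presheaf.stalk η)) :=
    Ideal.Quotient.field (maximalIdeal (Y.presheaf.stalk η))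
  infer_instance




/-! ## §3b Chart selection with the three raw hypotheses (092's `exists_affine_chart` shape) -/

section Raw

/-- **(γ1) CHART SELECTION in the binder shape of res-type-092's `O25-signatures.lean` (`exists_affine_chart`), for any
dimension `m`.**  `Y → Spec k` locally of finite type, `η` with regular local ring of dimension `m`, `x` generators of
`𝔪_η`: an affine `U ∋ η` and sections `u` with germs EXACTLY `x` such that (hcl) every common zero of `u` in `U` lies
in `closure {η}`, (hreg) the local rings of `Y` there are regular, (hli) `u` is part of a regular system of parameters
there — the three hypotheses of res-D-pv-025's `isWeightedChart_ofGermFiltration` (p510567) for a GENERAL `Y`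
(no smoothness, no torus: `Reg(Y)` and `Reg(closure {η})` are open by excellence, shrink to `D(s)` by §1, Krull's
height theorem + Matsumura 14.2 at the common zeros).  The bundled conclusion `IsWeightedChart` is
`LexMaxCentreGlobal.exists_isWeightedChart_ofGermFiltration` (file `…LexMaxCentreGlobal`). [folklore] -/
theorem exists_affine_chart {k : Type u} [Field k] {Y : Scheme.{u}}
    (f : Y ⟶ Spec (.of k)) [LocallyOfFiniteType f] (η : Y) (hregη : IsRegularLocalRing (Y.presheaf.stalk η))
    {m : ℕ} (hdim : ringKrullDim (Y.presheaf.stalk η) = (m : WithBot ℕ∞))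
    (x : Fin m → Y.presheaf.stalk η) (hx : Ideal.span (Set.range x) = maximalIdeal (Y.presheaf.stalk η)) :
    ∃ (U : Y.affineOpens) (hηU : η ∈ (U : Y.Opens)) (u : Fin m → Γ(Y, U)),
      (∀ i, (Y.presheaf.germ (U : Y.Opens) η hηU).hom (u i) = x i) ∧
      (∀ (y : Y) (hy : y ∈ (U : Y.Opens)),
        (∀ i, (Y.presheaf.germ (U : Y.Opens) y hy).hom (u i) ∈ maximalIdeal (Y.presheaf.stalk y)) →
        y ∈ closure ({η} : Set Y)) ∧
      (∀ (y : Y) (hy : y ∈ (U : Y.Opens)),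
        (∀ i, (Y.presheaf.germ (U : Y.Opens) y hy).hom (u i) ∈ maximalIdeal (Y.presheaf.stalk y)) →
        IsRegularLocalRing (Y.presheaf.stalk y)) ∧
      (∀ (y : Y) (hy : y ∈ (U : Y.Opens))
        (h : ∀ i, (Y.presheaf.germ (U : Y.Opens) y hy).hom (u i) ∈ maximalIdeal (Y.presheaf.stalk y)),
        LinearIndependent (ResidueField (Y.presheaf.stalk y))
          (fun i => (maximalIdeal (Y.presheaf.stalk y)).toCotangent ⟨_, h i⟩)) := by
  classical
  haveI : IsLocallyNoetherian Y := LocallyOfFiniteType.isLocallyNoetherian f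
  -- the reduced closed subscheme `Z = closure {η}` and the open set `Ω` where `Y` and `Z` are regular
  let Z : Closeds Y := ⟨closure ({η} : Set Y), isClosed_closure⟩
  let ι := (vanishingIdeal Z).subschemeι
  have hRegY : IsOpen (Scheme.regularLocus Y) := isOpen_regularLocus_of_locallyOfFiniteType_field f
  have hRegZ : IsOpen (Scheme.regularLocus (vanishingIdeal Z).subscheme) :=
    isOpen_regularLocus_of_locallyOfFiniteType_field (ι ≫ f)
  let B : Set Y := ι.base '' (Scheme.regularLocus (vanishingIdeal Z).subscheme)ᶜ
  have hB : IsClosed B := ι.isClosedEmbedding.isClosedMap _ hRegZ.isClosed_compl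
  let Ω : Y.Opens := ⟨Scheme.regularLocus Y ∩ Bᶜ, hRegY.inter hB.isOpen_compl⟩
  -- `η ∈ Ω`
  obtain ⟨W₀, hW₀, hηW₀, -⟩ :=
    exists_isAffineOpen_mem_and_subset (X := Y) (x := η) (U := ⊤) (Opens.mem_top η)
  have hηΩ : η ∈ Ω := by
    refine ⟨hregη, ?_⟩
    rintro ⟨y', hy', hy'η⟩
    apply hy'
    change IsRegularLocalRing _
    rw [isRegularLocalRing_stalk_subscheme_iff, hy'η,
      stalkIdeal_vanishingIdeal_closure_eq ⟨W₀, hW₀⟩ hηW₀ hηW₀]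
    exact isRegularLocalRing_quotient_map_primeIdealOf_self ⟨W₀, hW₀⟩ hηW₀
  -- sections lifting the germs on an affine `W ⊆ Ω`
  obtain ⟨W, hηW, hWΩ, g, hg⟩ := exists_affineOpens_forall_germ_eq Ω hηΩ x
  letI algη : Algebra Γ(Y, W) (Y.presheaf.stalk η) := TopCat.Presheaf.algebra_section_stalk Y.presheaf ⟨η, hηW⟩
  haveI := W.2.isLocalization_stalk ⟨η, hηW⟩
  haveI : IsNoetherianRing Γ(Y, W) := IsLocallyNoetherian.component_noetherian W
  have hgerm : (Y.presheaf.germ (W : Y.Opens) η hηW).hom = algebraMap Γ(Y, W) (Y.presheaf.stalk η) := rfl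
  -- `(g)` and `𝔭_η` agree at `η`
  have hxm : ∀ i, x i ∈ maximalIdeal (Y.presheaf.stalk η) := fun i =>
    hx ▸ Ideal.subset_span (Set.mem_range_self i)
  have hgP : Ideal.span (Set.range g) ≤ (W.2.primeIdealOf ⟨η, hηW⟩).asIdeal := by
    refine Ideal.span_le.mpr (Set.range_subset_iff.mpr fun i => ?_)
    rw [SetLike.mem_coe, ← germ_mem_maximalIdeal_iff_mem_primeIdealOf W hηW (g i), hg i]
    exact hxm i
  have hpx : ((W.2.primeIdealOf ⟨η, hηW⟩).asIdeal).map (algebraMap Γ(Y, W) (Y.presheaf.stalk η)) ≤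
      (Ideal.span (Set.range g)).map (algebraMap Γ(Y, W) (Y.presheaf.stalk η)) := by
    rw [← IsLocalization.AtPrime.under_maximalIdeal (Y.presheaf.stalk η) (W.2.primeIdealOf ⟨η, hηW⟩).asIdeal,
      Ideal.under_def, IsLocalization.map_under (W.2.primeIdealOf ⟨η, hηW⟩).asIdeal.primeCompl
        (S := Y.presheaf.stalk η), Ideal.map_span, ← Set.range_comp, ← hx]
    have hcomp : ((algebraMap Γ(Y, W) (Y.presheaf.stalk η)) ∘ g) = x := funext fun i => hg i
    rw [hcomp]
  obtain ⟨s, hs, hloc⟩ := exists_not_mem_forall_map_eq (Ideal.span (Set.range g))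
    (W.2.primeIdealOf ⟨η, hηW⟩).asIdeal hgP (Y.presheaf.stalk η) hpx
  -- the chart `U = D(s)` and the restricted sections
  let U : Y.affineOpens := Y.affineBasicOpen s
  have hUW : (U : Y.Opens) ≤ W := Y.basicOpen_le s
  have hηU : η ∈ (U : Y.Opens) := by
    change η ∈ Y.basicOpen s
    rw [Y.mem_basicOpen s η hηW]
    have : s ∉ (W.2.primeIdealOf ⟨η, hηW⟩).asIdeal := hs
    rw [← germ_mem_maximalIdeal_iff_mem_primeIdealOf W hηW s, mem_maximalIdeal, mem_nonunits_iff, not_not] at this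
    exact this
  let u : Fin m → Γ(Y, U) := fun i => (Y.presheaf.map (homOfLE hUW).op).hom (g i)
  have hres : ∀ (y : Y) (hyU : y ∈ (U : Y.Opens)) (i : Fin m),
      (Y.presheaf.germ (U : Y.Opens) y hyU).hom (u i) = (Y.presheaf.germ (W : Y.Opens) y (hUW hyU)).hom (g i) :=
    fun y hyU i => TopCat.Presheaf.germ_res_apply Y.presheaf (homOfLE hUW) y hyU (g i)
  have hu : ∀ i, (Y.presheaf.germ (U : Y.Opens) η hηU).hom (u i) = x i := fun i => by rw [hres, hg]
  -- at a point `y ∈ U`: the local ring is a localization of `Γ(Y, W)` off `s`, so `(g)𝒪_y = 𝔭_η 𝒪_y`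
  have key : ∀ (y : Y) (hyU : y ∈ (U : Y.Opens)),
      Ideal.span (Set.range fun i => (Y.presheaf.germ (U : Y.Opens) y hyU).hom (u i)) =
        ((W.2.primeIdealOf ⟨η, hηW⟩).asIdeal).map (Y.presheaf.germ (W : Y.Opens) y (hUW hyU)).hom := by
    intro y hyU
    letI algy : Algebra Γ(Y, W) (Y.presheaf.stalk y) :=
      TopCat.Presheaf.algebra_section_stalk Y.presheaf ⟨y, hUW hyU⟩
    haveI := W.2.isLocalization_stalk ⟨y, hUW hyU⟩
    have hsy : s ∉ (W.2.primeIdealOf ⟨y, hUW hyU⟩).asIdeal := by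
      rw [← germ_mem_maximalIdeal_iff_mem_primeIdealOf W (hUW hyU) s, mem_maximalIdeal, mem_nonunits_iff,
        not_not]
      exact (Y.mem_basicOpen s y (hUW hyU)).mp hyU
    have h := hloc (W.2.primeIdealOf ⟨y, hUW hyU⟩).asIdeal hsy (Y.presheaf.stalk y)
    rw [Ideal.map_span, ← Set.range_comp] at h
    have hfun : (fun i => (Y.presheaf.germ (U : Y.Opens) y hyU).hom (u i)) =
        (algebraMap Γ(Y, W) (Y.presheaf.stalk y)) ∘ g := funext fun i => hres y hyU i
    rw [hfun]
    exact h
  have hcl : ∀ (y : Y) (hy : y ∈ (U : Y.Opens)),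
      (∀ i, (Y.presheaf.germ (U : Y.Opens) y hy).hom (u i) ∈ maximalIdeal (Y.presheaf.stalk y)) →
      y ∈ closure ({η} : Set Y) := by
    intro y hyU hyu
    letI algy : Algebra Γ(Y, W) (Y.presheaf.stalk y) :=
      TopCat.Presheaf.algebra_section_stalk Y.presheaf ⟨y, hUW hyU⟩
    haveI := W.2.isLocalization_stalk ⟨y, hUW hyU⟩
    refine mem_closure_of_primeIdealOf_le W hηW (hUW hyU) fun a ha => ?_
    have hle : Ideal.span (Set.range fun i => (Y.presheaf.germ (U : Y.Opens) y hyU).hom (u i)) ≤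
        maximalIdeal (Y.presheaf.stalk y) :=
      Ideal.span_le.mpr (Set.range_subset_iff.mpr hyu)
    rw [key y hyU] at hle
    have ha' := hle (Ideal.mem_map_of_mem _ ha)
    exact (IsLocalization.AtPrime.to_map_mem_maximal_iff (Y.presheaf.stalk y)
      (W.2.primeIdealOf ⟨y, hUW hyU⟩).asIdeal a).mp ha'
  refine ⟨U, hηU, u, hu, hcl, ?_, ?_⟩
  · -- regular stalks on `U ⊆ Ω`
    intro y hyU _
    exact (hWΩ (hUW hyU)).1
  · -- independence in the cotangent space at the common zeros of `u`
    intro y hyU hyu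
    have hyW : y ∈ (W : Y.Opens) := hUW hyU
    letI algy : Algebra Γ(Y, W) (Y.presheaf.stalk y) := TopCat.Presheaf.algebra_section_stalk Y.presheaf ⟨y, hyW⟩
    haveI := W.2.isLocalization_stalk ⟨y, hyW⟩
    haveI : IsRegularLocalRing (Y.presheaf.stalk y) := (hWΩ hyW).1
    have hyc : y ∈ closure ({η} : Set Y) := hcl y hyU hyu
    set z : Fin m → Y.presheaf.stalk y := fun i => (Y.presheaf.germ (U : Y.Opens) y hyU).hom (u i) with hz
    -- `Q := (z) = 𝔭_η 𝒪_y` is a prime of height `m`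
    have hQ : Ideal.span (Set.range z) = ((W.2.primeIdealOf ⟨η, hηW⟩).asIdeal).map
        (algebraMap Γ(Y, W) (Y.presheaf.stalk y)) := key y hyU
    have hle := primeIdealOf_le_of_mem_closure W hηW hyW hyc
    have hdisj : Disjoint ((W.2.primeIdealOf ⟨y, hyW⟩).asIdeal.primeCompl : Set Γ(Y, W))
        ((W.2.primeIdealOf ⟨η, hηW⟩).asIdeal : Set Γ(Y, W)) :=
      Set.disjoint_left.mpr fun a ha haη => ha (hle haη)
    haveI hQprime : (Ideal.span (Set.range z)).IsPrime := by
      rw [hQ]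
      exact IsLocalization.isPrime_of_isPrime_disjoint _ (Y.presheaf.stalk y) _ inferInstance hdisj
    have hQheight : (Ideal.span (Set.range z)).height = m := by
      rw [hQ, IsLocalization.height_map_of_disjoint (W.2.primeIdealOf ⟨y, hyW⟩).asIdeal.primeCompl _ hdisj]
      exact height_primeIdealOf_eq W hηW m hdim
    -- the quotient `𝒪_y ⧸ Q` is the (regular) local ring of the reduced `closure {η}` at `y`
    haveI : IsRegularLocalRing (Y.presheaf.stalk y ⧸ Ideal.span (Set.range z)) := by
      have hyZ : y ∈ Set.range ι.base := by
        rw [Scheme.IdealSheafData.range_subschemeι, Scheme.IdealSheafData.coe_support_vanishingIdeal]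
        exact hyc
      obtain ⟨y', hy'⟩ := hyZ
      have hreg' : IsRegularLocalRing ((vanishingIdeal Z).subscheme.presheaf.stalk y') := by
        by_contra hnot
        exact (hWΩ hyW).2 ⟨y', hnot, hy'⟩
      have h := isRegularLocalRing_quotient_map_primeIdealOf W hηW hyW y' hy' hreg'
      rw [hQ]
      exact h
    -- no `zᵢ` is redundant: Krull's height theorem
    have hmin : ∀ i, z i ∉ Ideal.span (z '' {j | j ≠ i}) := by
      intro i hi
      have hS : ({j : Fin m | j ≠ i} : Set (Fin m)) = ↑(Finset.univ.erase i) := by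
        ext j; simp
      rw [hS] at hi
      have heq : Ideal.span (Set.range z) = Ideal.span (z '' ↑(Finset.univ.erase i)) := by
        apply le_antisymm
        · refine Ideal.span_le.mpr (Set.range_subset_iff.mpr fun j => ?_)
          by_cases hji : j = i
          · subst hji; exact hi
          · exact Ideal.subset_span ⟨j, by simp [hji], rfl⟩
        · exact Ideal.span_mono (Set.image_subset_range _ _)
      have hmem : Ideal.span (Set.range z) ∈
          (Ideal.span (↑((Finset.univ.erase i).image z) : Set (Y.presheaf.stalk y))).minimalPrimes := by
        rw [Finset.coe_image, ← heq, Ideal.minimalPrimes_eq_subsingleton_self]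
        exact Set.mem_singleton _
      have hcard := Ideal.height_le_card_of_mem_minimalPrimes_span_finset hmem
      rw [hQheight] at hcard
      have hc : ((Finset.univ.erase i).image z).card ≤ m - 1 :=
        Finset.card_image_le.trans (by rw [Finset.card_erase_of_mem (Finset.mem_univ i), Finset.card_fin])
      have hm : 1 ≤ m := Nat.one_le_iff_ne_zero.mpr (fun h => by subst h; exact Fin.elim0 i)
      have h1 : (m : ℕ∞) ≤ ((m - 1 : ℕ) : ℕ∞) := hcard.trans (by exact_mod_cast hc)
      have h2 : m ≤ m - 1 := by exact_mod_cast h1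
      omega
    exact linearIndependent_toCotangent_of_isRegularLocalRing_quotient z hyu hmin


end Raw

end Summit.ResolutionOfSingularities.ResolutionOfSingularities.Theorems.LexMaxCentreGlobal

end
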